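import Literature.Probability.LatticeModels.IsingLimitLaw
import Literature.Probability.LatticeModels.CurieWeissDensity
import HarnessLib

/-!
# Discharge of `isIsingLimitLaw_phi4`: `e^{-a u⁴ - b u²} du` is an Ising limit law (Simon–Griffiths)

Sibling proof file of `IsingLimitLaw.lean` (which vendors the named fact
`Literature.Probability.LatticeModels.isIsingLimitLaw_phi4`) next to `IsingLimitLawProofs.lean` (the
GHS discharge). It proves

* `Literature.Probability.LatticeModels.isIsingLimitLaw_phi4_holds : isIsingLimitLaw_phi4` — for
  `a > 0`, `b ∈ ℝ`, the probability law `∝ e^{-a u⁴ - b u²} du` is an `IsIsingLimitLaw`: a weak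
  limit of magnetization laws of finite ferromagnetic Ising systems with nonnegative weights whose
  Gaussian-exponential moments `∫ e^{βu²}` stay bounded,

following

* B. Simon, R. B. Griffiths, *The (φ⁴)₂ field theory as a classical Ising model*, Commun. Math.
  Phys. **33** (1973) 145–164, doi:10.1007/bf01645626 (`SimonGriffiths1973` = the stub key
  `GriffithsSimon1973` of the fact's docstring), §2, Theorem 1 and its proof (pp. 148–151).

The analysis (step densities of the scaled Curie–Weiss total spin, their pointwise limit and
Gaussian domination, dominated convergence) is `CurieWeissDensity.lean`
(`SimonGriffiths.tendsto_latticeAverage`); the binomial/Stirling estimates are `BinomialEntropy.lean`.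
This file declares no definition.

## The proof

1. **The Curie–Weiss magnetization law is a tilted binomial** (`integral_isingMagnetizationLaw_const`):
   for constant couplings `Jᵢⱼ = c` and weights `wᵢ = d` on `Fin n`,
   `Σᵢⱼ Jᵢⱼ sᵢ sⱼ = c (Σ sᵢ)²`, `Σ wᵢ sᵢ = d Σ sᵢ`, `Σ sᵢ = 2·#{up} - n`, and grouping the `2ⁿ`
   configurations by their number of up spins (`sum_config_eq_sum_choose`, via
   `(Fin n → Bool) ≃ Finset (Fin n)` and `Finset.sum_powerset_apply_card`) gives
   `∫ φ d(law) = Σ_k C(n,k) e^{c(2k-n)²} φ(d(2k-n)) / Σ_k C(n,k) e^{c(2k-n)²}`.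
2. With `n = N = M⁴`, `c = γ_M/N`, `d = δ_M` this is the lattice average
   `Σ_j W_M(j) φ(u_j) / Σ_j W_M(j)` of `CurieWeissDensity` (`SimonGriffiths.integral_cwLaw`).
3. **The sequence**: `k ↦ M = k + M₁`, `M₁ = ⌈2|β|⌉ + 2` (`β = bλ²`), `N = M⁴` spins,
   `Jᵢⱼ = γ_M/N = (1/2 - β/M²)/M⁴ ≥ 0` (`SimonGriffiths.gamma_nonneg`), `wᵢ = δ_M = λ/M³ ≥ 0`.
4. **Weak convergence** by `ProbabilityMeasure.tendsto_iff_forall_integral_tendsto`: for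
   `f : ℝ →ᵇ ℝ`, `∫ f d(law_M) → ∫ f e^{-a u⁴ - b u²} / ∫ e^{-a u⁴ - b u²} = ∫ f dν`
   (`SimonGriffiths.tendsto_latticeAverage` with `|f| ≤ ‖f‖ e^{0·u²}`; the identification of `∫ · dν`
   for `ν = Z⁻¹ e^{-a u⁴ - b u²} du` is `SimonGriffiths.integral_phi4Law`).
5. **Moments**: for each `β'`, `∫ e^{β'u²} d(law_M)` converges by the same theorem
   (`φ = e^{β'u²}`, `|φ| ≤ 1 · e^{β'u²}`), hence is bounded (`Filter.Tendsto.bddAbove_range`).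

## Mathlib / tree anchors

`ProbabilityMeasure.tendsto_iff_forall_integral_tendsto`, `PMF.integral_eq_sum`,
`PMF.toMeasure_map`, `integral_map`, `Finset.sum_powerset_apply_card`, `Fintype.sum_equiv`,
`integral_smul_measure`, `integral_withDensity_eq_integral_toReal_smul`,
`ofReal_integral_eq_lintegral_ofReal`, `Filter.Tendsto.bddAbove_range`, `tendsto_add_atTop_nat`;
tree: `isingMagnetizationLaw`, `isingPairPMF`, `isingBoltzmann`, `isingPairEnergy`,
`weightedMagnetization`, `spinVal`, `measurable_of_config` (`IsingLimitLaw`),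
`SimonGriffiths.tendsto_latticeAverage`, `cwWeight`, `site`, `mesh`, `gamma`, `beta`,
`phi4Density`, `integrable_phi4Density` (`CurieWeissDensity`).
-/

noncomputable section

open MeasureTheory Filter Topology

namespace Literature.Probability.LatticeModels

/-! ### The Curie–Weiss magnetization law is a binomial mixture -/

section CurieWeiss

variable {n : ℕ}

/-- `Σᵢ sᵢ = 2 #{up spins} - n`. [folklore] -/
theorem sum_spinVal (s : Fin n → Bool) : ∑ i, spinVal s i = 2 * ((Finset.univ.filter fun i => s i = true).card : ℝ) - n := by
  rw [Finset.card_filter]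
  push_cast
  rw [Finset.mul_sum]
  have h : ∀ i, spinVal s i = 2 * (if s i = true then (1 : ℝ) else 0) - 1 := by
    intro i; unfold spinVal; split_ifs <;> norm_num
  simp_rw [h]
  rw [Finset.sum_sub_distrib]
  simp

/-- Constant couplings give the Curie–Weiss energy `c (Σᵢ sᵢ)²`. [folklore] -/
theorem isingPairEnergy_const (c : ℝ) (s : Fin n → Bool) :
    isingPairEnergy (fun _ _ => c) s = c * (∑ i, spinVal s i) ^ 2 := by
  unfold isingPairEnergy
  rw [sq, Finset.sum_mul_sum, Finset.mul_sum]
  refine Finset.sum_congr rfl fun i _ => ?_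
  rw [Finset.mul_sum]
  refine Finset.sum_congr rfl fun j _ => ?_
  ring

/-- Constant weights give the scaled total spin `d Σᵢ sᵢ`. [folklore] -/
theorem weightedMagnetization_const (d : ℝ) (s : Fin n → Bool) :
    weightedMagnetization (fun _ => d) s = d * ∑ i, spinVal s i := by
  unfold weightedMagnetization; rw [Finset.mul_sum]

/-- **Grouping configurations by their number of up spins**:
`Σ_s G(#up(s)) = Σ_{k=0}^{n} C(n, k) G(k)`. [folklore] -/
theorem sum_config_eq_sum_choose (G : ℕ → ℝ) :
    ∑ s : Fin n → Bool, G ((Finset.univ.filter fun i => s i = true).card) =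
      ∑ k ∈ Finset.range (n + 1), (n.choose k : ℝ) * G k := by
  let e : (Fin n → Bool) ≃ Finset (Fin n) :=
    { toFun := fun s => Finset.univ.filter fun i => s i = true
      invFun := fun t i => decide (i ∈ t)
      left_inv := fun s => by funext i; simp
      right_inv := fun t => by ext i; simp }
  rw [show ∑ s : Fin n → Bool, G ((Finset.univ.filter fun i => s i = true).card) = ∑ s, G (e s).card from rfl,
    Fintype.sum_equiv e (fun s => G (e s).card) (fun t => G t.card) (fun s => rfl),
    ← Finset.powerset_univ, Finset.sum_powerset_apply_card]
  simp [nsmul_eq_mul]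

/-- **The Curie–Weiss magnetization law is a tilted binomial**: for constant couplings `c` and
constant weights `d`,
`∫ φ d(law) = Σ_k C(n,k) e^{c(2k-n)²} φ(d(2k-n)) / Σ_k C(n,k) e^{c(2k-n)²}`.
[cite: SimonGriffiths1973, §2 proof of Thm. 1] -/
theorem integral_isingMagnetizationLaw_const (n : ℕ) (c d : ℝ) {φ : ℝ → ℝ} (hφ : Continuous φ) :
    ∫ u, φ u ∂(isingMagnetizationLaw n (fun _ _ => c) (fun _ => d) : Measure ℝ) =
      (∑ k ∈ Finset.range (n + 1),
          (n.choose k : ℝ) * Real.exp (c * (2 * k - n) ^ 2) * φ (d * (2 * k - n))) /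
        ∑ k ∈ Finset.range (n + 1), (n.choose k : ℝ) * Real.exp (c * (2 * k - n) ^ 2) := by
  set J : Fin n → Fin n → ℝ := fun _ _ => c
  set w : Fin n → ℝ := fun _ => d
  change ∫ u, φ u ∂((isingPairPMF J).map (weightedMagnetization w)).toMeasure = _
  rw [← PMF.toMeasure_map (weightedMagnetization w) (isingPairPMF J) (measurable_of_config _),
    integral_map (measurable_of_config _).aemeasurable hφ.aestronglyMeasurable,
    PMF.integral_eq_sum]
  have hp : ∀ s, ((isingPairPMF J) s).toReal = isingBoltzmann J s / isingPairPartition J := by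
    intro s
    rw [isingPairPMF, PMF.ofFintype_apply, ENNReal.toReal_ofReal
      (div_nonneg (isingBoltzmann_pos J s).le (isingPairPartition_pos J).le)]
  have hB : ∀ s, isingBoltzmann J s = Real.exp (c * (2 * ((Finset.univ.filter fun i => s i = true).card : ℝ) - n) ^ 2) := by
    intro s; rw [isingBoltzmann, isingPairEnergy_const, sum_spinVal]
  have hM : ∀ s, weightedMagnetization w s = d * (2 * ((Finset.univ.filter fun i => s i = true).card : ℝ) - n) := by
    intro s; rw [weightedMagnetization_const, sum_spinVal]
  have hZ : isingPairPartition J =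
      ∑ k ∈ Finset.range (n + 1), (n.choose k : ℝ) * Real.exp (c * (2 * k - n) ^ 2) := by
    unfold isingPairPartition
    simp_rw [hB]
    exact sum_config_eq_sum_choose (fun k => Real.exp (c * (2 * k - n) ^ 2))
  simp_rw [hp, hM, hB, smul_eq_mul, div_mul_eq_mul_div, ← Finset.sum_div]
  rw [hZ, sum_config_eq_sum_choose (fun k => Real.exp (c * (2 * k - n) ^ 2) * φ (d * (2 * k - n)))]
  congr 1
  refine Finset.sum_congr rfl fun k _ => ?_
  ring

end CurieWeiss

/-! ### The approximating sequence and its magnetization laws -/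

namespace SimonGriffiths

/-- The integral of `φ` against the `M`-th Curie–Weiss magnetization law
(`N = M⁴` spins, `Jᵢⱼ = γ_M/N`, `wᵢ = δ_M`) is the lattice average `Σ_j W_M(j) φ(u_j)/Σ_j W_M(j)`.
[cite: SimonGriffiths1973, §2 proof of Thm. 1] -/
theorem integral_cwLaw (a b : ℝ) {M : ℕ} (hM : M ≠ 0) {φ : ℝ → ℝ} (hφ : Continuous φ) :
    ∫ u, φ u ∂(isingMagnetizationLaw (M ^ 4) (fun _ _ => gamma a b M / (M : ℝ) ^ 4)
        (fun _ => mesh a M) : Measure ℝ) =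
      (∑ j ∈ Finset.range (M ^ 4 + 1), cwWeight a b M j * φ (site a M j)) /
        ∑ j ∈ Finset.range (M ^ 4 + 1), cwWeight a b M j := by
  rw [integral_isingMagnetizationLaw_const _ _ _ hφ]
  have hM' : (M : ℝ) ≠ 0 := by exact_mod_cast hM
  have hW : ∀ k : ℕ, ((M ^ 4).choose k : ℝ) *
      Real.exp (gamma a b M / (M : ℝ) ^ 4 * (2 * k - ((M ^ 4 : ℕ) : ℝ)) ^ 2) = cwWeight a b M k := by
    intro k
    unfold cwWeight siteX
    push_cast
    congr 2
    field_simp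
  have hS : ∀ k : ℕ, mesh a M * (2 * k - ((M ^ 4 : ℕ) : ℝ)) = site a M k := by
    intro k; unfold site; push_cast; ring
  simp_rw [hW, hS]

/-- `γ_{k + M₁} ≥ 0`: the approximants are ferromagnetic ("`H_N` is ferromagnetic for `N` large").
[cite: SimonGriffiths1973, §2 proof of Thm. 1] -/
theorem gamma_shift_nonneg (a b : ℝ) (k : ℕ) : 0 ≤ gamma a b (k + (⌈2 * |SimonGriffiths.beta a b|⌉₊ + 2)) := by
  refine gamma_nonneg ?_
  push_cast
  linarith [Nat.le_ceil (2 * |beta a b|)]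

/-- **Integrals against the normalised `φ⁴` law** `ν = Z⁻¹ e^{-a u⁴ - b u²} du`:
`∫ φ dν = ∫ φ e^{-a u⁴ - b u²} / ∫ e^{-a u⁴ - b u²}`. [folklore] -/
theorem integral_phi4Law {a : ℝ} (ha : 0 < a) (b : ℝ) {ν : Measure ℝ}
    (hν : ν = (∫⁻ u, ENNReal.ofReal (Real.exp (-a * u ^ 4 - b * u ^ 2)))⁻¹ •
        volume.withDensity (fun u => ENNReal.ofReal (Real.exp (-a * u ^ 4 - b * u ^ 2))))
    (φ : ℝ → ℝ) :
    ∫ u, φ u ∂ν = (∫ u, φ u * phi4Density a b u) / (∫ u, phi4Density a b u) := by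
  have hmeas : Measurable fun u => ENNReal.ofReal (Real.exp (-a * u ^ 4 - b * u ^ 2)) :=
    (continuous_phi4Density a b).measurable.ennreal_ofReal
  rw [hν, integral_smul_measure, integral_withDensity_eq_integral_toReal_smul hmeas
    (Eventually.of_forall fun _ => ENNReal.ofReal_lt_top)]
  have hint : ∫⁻ u, ENNReal.ofReal (Real.exp (-a * u ^ 4 - b * u ^ 2)) =
      ENNReal.ofReal (∫ u, phi4Density a b u) :=
    (ofReal_integral_eq_lintegral_ofReal (integrable_phi4Density ha b)
      (Eventually.of_forall fun u => (phi4Density_pos a b u).le)).symm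
  rw [hint, ENNReal.toReal_inv, ENNReal.toReal_ofReal (integral_nonneg fun u =>
    (phi4Density_pos a b u).le), smul_eq_mul, div_eq_inv_mul]
  congr 1
  refine integral_congr_ae (Eventually.of_forall fun u => ?_)
  simp only [phi4Density, smul_eq_mul]
  rw [ENNReal.toReal_ofReal (Real.exp_pos _).le, mul_comm]

end SimonGriffiths

/-! ### The discharge -/

/-- **Simon–Griffiths 1973, Theorem 1** — the tree's named fact `isIsingLimitLaw_phi4` is a theorem:
for `a > 0`, `b ∈ ℝ`, the law `∝ e^{-a u⁴ - b u²} du` is an Ising limit law. The approximants are the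
magnetization laws of `N = M⁴` spins, `M = k + M₁`, with ferromagnetic Curie–Weiss couplings
`Jᵢⱼ = (1/2 - bλ²/M²)/N ≥ 0` and weights `wᵢ = λ/M³ ≥ 0` (`λ = (12a)^{-1/4}`); weak convergence by
`ProbabilityMeasure.tendsto_iff_forall_integral_tendsto` and `SimonGriffiths.tendsto_latticeAverage`;
the Gaussian-exponential moments converge too, hence are bounded. [cite: SimonGriffiths1973, §2 Thm. 1] -/
theorem isIsingLimitLaw_phi4_holds : isIsingLimitLaw_phi4 := by
  intro a b ha ν hν
  refine ⟨fun k => (k + (⌈2 * |SimonGriffiths.beta a b|⌉₊ + 2)) ^ 4,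
    fun k _ _ => SimonGriffiths.gamma a b (k + (⌈2 * |SimonGriffiths.beta a b|⌉₊ + 2)) /
      ((k + (⌈2 * |SimonGriffiths.beta a b|⌉₊ + 2) : ℕ) : ℝ) ^ 4,
    fun k _ => SimonGriffiths.mesh a (k + (⌈2 * |SimonGriffiths.beta a b|⌉₊ + 2)),
    fun k _ _ => div_nonneg (SimonGriffiths.gamma_shift_nonneg a b k) (by positivity),
    fun k _ => (SimonGriffiths.mesh_pos ha (by omega)).le, ?_, ?_⟩
  · -- weak convergence
    rw [ProbabilityMeasure.tendsto_iff_forall_integral_tendsto]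
    intro f
    have hb : ∀ u, |f u| ≤ ‖f‖ * Real.exp (0 * u ^ 2) := fun u => by
      simpa using f.norm_coe_le_norm u
    have hlat := (SimonGriffiths.tendsto_latticeAverage ha b f.continuous hb).comp
      (tendsto_add_atTop_nat ((⌈2 * |SimonGriffiths.beta a b|⌉₊ + 2)))
    rw [SimonGriffiths.integral_phi4Law ha b hν]
    refine hlat.congr fun k => ?_
    simp only [Function.comp_def]
    exact (SimonGriffiths.integral_cwLaw a b (by omega) f.continuous).symm
  · -- uniform Gaussian-exponential moments
    intro b₂
    have hb : ∀ u, |Real.exp (b₂ * u ^ 2)| ≤ 1 * Real.exp (b₂ * u ^ 2) := fun u => by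
      rw [abs_of_pos (Real.exp_pos _), one_mul]
    have hlat := (SimonGriffiths.tendsto_latticeAverage ha b (φ := fun u => Real.exp (b₂ * u ^ 2))
      (by fun_prop) hb).comp (tendsto_add_atTop_nat ((⌈2 * |SimonGriffiths.beta a b|⌉₊ + 2)))
    obtain ⟨C, hC⟩ := hlat.bddAbove_range
    refine ⟨C, fun k => hC ⟨k, ?_⟩⟩
    simp only [Function.comp_def]
    exact (SimonGriffiths.integral_cwLaw a b (by omega)
      (φ := fun u => Real.exp (b₂ * u ^ 2)) (by fun_prop)).symm

end Literature.Probability.LatticeModels
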